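import Summits.AtomisticToContinuum.Crystallization.Theorems.FrustratedLawDichotomyStrainedPatchHomLeafCheck

/-!
# COMPUTABLE twins of the (P4) fcc Gram-leaf checker (CERT-DESIGN-g44 §9 (D4) instrument mode; critic row 799 (b))

decomp-a2c hand-2 g21 (crux `AperiodicFrustratedLawGap`, stmt-AtomisticToContinuum-27623).  `…HomLeafCheck.termsOK / sumV / sumG / sumC` are
`noncomputable` for ONE reason: with Mathlib imported, `Finset.Icc (-7 : ℤ) 7` elaborates through the noncomputable instance
`Int.instConditionallyCompleteLinearOrder`, so the label box `box7` does not compile (the KERNEL evaluates it fine).  Row 799 (b) puts the fcc half in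
INSTRUMENT mode = «the SAME check function, compiled and run natively».  This module provides exactly that:

* `iccC` — the computable interval `{−7,…,7}` as a mapped `Finset.range`, with `iccC_eq : iccC = Finset.Icc (-7) 7`;
* `boxC` — the computable label box, `boxC_eq : boxC = box7`;
* `termsOKc`, `gradAc`, `sumVc`, `sumGc`, `sumCc` — byte-for-byte the definitions of `…HomLeafCheck` with `boxC` for `box7`, hence COMPILABLE (`#eval`,
  `lake exe`), and the equalities `termsOKc_eq`, `sumVc_eq`, `sumGc_eq`, `sumCc_eq`;
* ★ `leaf_sound_c` — `…HomLeafCheck.leaf_sound` restated over the computable twins: a native run of `(termsOKc, sumVc, sumGc, sumCc)` on a leaf record IS an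
  evaluation of the functions whose soundness theorem is in the tree (D4's instrument-of-record reading).

No new mathematics; 0 sorry; standard axioms; no instances / notation.  `--supports stmt-AtomisticToContinuum-27623`.
-/

namespace Summit.AtomisticToContinuum.Crystallization.Theorems.FrustratedLawDichotomyStrainedPatchHomLeafCheckC

open scoped BigOperators RealInnerProductSpace
open Literature.Analysis.ValidatedNumerics.Numerics
open Summit.AtomisticToContinuum.Crystallization.Theorems.ChargedEnergyGapNegative (E3)
open Summit.AtomisticToContinuum.Crystallization.Theorems.FrustratedLawDichotomySchurCut (effPot w₄₅ ω₄)
open Summit.AtomisticToContinuum.Crystallization.Theorems.FrustratedLawDichotomyStrainedPatchHomSplit (latPt)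
open Summit.AtomisticToContinuum.Crystallization.Theorems.FrustratedLawDichotomyStrainedPatchHomTermEval
open Summit.AtomisticToContinuum.Crystallization.Theorems.FrustratedLawDichotomyStrainedPatchHomTermEvalPoint
open Summit.AtomisticToContinuum.Crystallization.Theorems.FrustratedLawDichotomyStrainedPatchHomLeafCheck
open Literature.Barriers.AtomisticToContinuum.FlatleyTheil2015 (fccVec)

/-! ## §1. A computable label box equal to `box7` -/

/-- `{−7, …, 7}` as a computable `Finset` (image of `range 15`). -/
def iccC : Finset ℤ := (Finset.range 15).image fun n : ℕ => (n : ℤ) - 7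

/-- `iccC` is the interval `[−7, 7]`. [formal bookkeeping] -/
theorem iccC_eq : iccC = Finset.Icc (-7 : ℤ) 7 := by
  ext x
  simp only [iccC, Finset.mem_image, Finset.mem_range, Finset.mem_Icc]
  constructor
  · rintro ⟨n, hn, rfl⟩; omega
  · rintro ⟨h1, h2⟩; exact ⟨(x + 7).toNat, by omega, by omega⟩

/-- The computable label box `[−7,7]³ ∖ 0`. -/
def boxC : Finset (Fin 3 → ℤ) := (Fintype.piFinset fun _ : Fin 3 => iccC).filter (fun b => b ≠ 0)

/-- `boxC = box7`. [formal bookkeeping] -/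
theorem boxC_eq : boxC = box7 := by
  unfold boxC box7; rw [iccC_eq]

/-! ## §2. The computable twins and their equalities -/

/-- Computable twin of `termsOK`. -/
def termsOKc (c0 w : Fin 9 → ℤ) : Bool :=
  decide (∀ k, 0 ≤ w k) &&
  decide (∀ b ∈ boxC,
    curvOK (q0z c0 b - rz w b) (q0z c0 b + rz w b) (curvM (q0z c0 b - rz w b) (q0z c0 b + rz w b)) = true ∧
    valLoOK (q0z c0 b) (valLo (q0z c0 b)) = true ∧
    derivOK (q0z c0 b) (derivLo (q0z c0 b)) (derivHi (q0z c0 b)) = true)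

/-- Computable twin of `gradA`. -/
def gradAc (c0 : Fin 9 → ℤ) (k : Fin 9) : ℤ :=
  ∑ b ∈ boxC, max |derivLo (q0z c0 b) * Lz b k| |derivHi (q0z c0 b) * Lz b k|

/-- Computable twin of `sumV`. -/
def sumVc (c0 : Fin 9 → ℤ) : ℤ := ∑ b ∈ boxC, valLo (q0z c0 b)

/-- Computable twin of `sumG`. -/
def sumGc (c0 w : Fin 9 → ℤ) : ℤ := ∑ k, cdiv (gradAc c0 k * w k) SC

/-- Computable twin of `sumC`. -/
def sumCc (c0 w : Fin 9 → ℤ) : ℤ := cdiv (∑ b ∈ boxC, curvM (q0z c0 b - rz w b) (q0z c0 b + rz w b) * rz w b ^ 2) (2 * (SC : ℤ) * SC)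

/-- [formal bookkeeping] -/
theorem termsOKc_eq (c0 w : Fin 9 → ℤ) : termsOKc c0 w = termsOK c0 w := by
  unfold termsOKc termsOK; rw [boxC_eq]

/-- [formal bookkeeping] -/
theorem gradAc_eq (c0 : Fin 9 → ℤ) (k : Fin 9) : gradAc c0 k = gradA c0 k := by
  unfold gradAc gradA; rw [boxC_eq]

/-- [formal bookkeeping] -/
theorem sumVc_eq (c0 : Fin 9 → ℤ) : sumVc c0 = sumV c0 := by
  unfold sumVc sumV; rw [boxC_eq]

/-- [formal bookkeeping] -/
theorem sumGc_eq (c0 w : Fin 9 → ℤ) : sumGc c0 w = sumG c0 w := by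
  unfold sumGc sumG; simp only [gradAc_eq]

/-- [formal bookkeeping] -/
theorem sumCc_eq (c0 w : Fin 9 → ℤ) : sumCc c0 w = sumC c0 w := by
  unfold sumCc sumC; rw [boxC_eq]

/-! ## §3. Soundness over the computable twins -/

/-- ★ **`leaf_sound` over the computable twins** (instrument-of-record reading of (D4): the natively executed functions are, by the equalities of §2, the very
functions of the tree theorem). [folklore] -/
theorem leaf_sound_c {c0 w : Fin 9 → ℤ} {μ s₁ s₂ s₃ : ℤ} (h : termsOKc c0 w = true) (e₁ : sumVc c0 = s₁) (e₂ : sumGc c0 w = s₂) (e₃ : sumCc c0 w = s₃)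
    (hineq : μ ≤ s₁ - s₂ - s₃) (G : E3 →L[ℝ] E3)
    (hbox : ∀ k : Fin 9, |⟪G (fccVec ((@finProdFinEquiv 3 3).symm k).1), G (fccVec ((@finProdFinEquiv 3 3).symm k).2)⟫ - (c0 k : ℝ) / SC| ≤
      (w k : ℝ) / SC) :
    (μ : ℝ) / SC ≤ ∑ b ∈ (Fintype.piFinset fun _ : Fin 3 => Finset.Icc (-7 : ℤ) 7).filter (fun b => b ≠ 0), effPot w₄₅ ω₄ (3 / 400) ‖latPt G fccVec b‖ :=
  leaf_sound (by rw [← termsOKc_eq]; exact h) (by rw [← sumVc_eq]; exact e₁) (by rw [← sumGc_eq]; exact e₂) (by rw [← sumCc_eq]; exact e₃) hineq G hbox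

end Summit.AtomisticToContinuum.Crystallization.Theorems.FrustratedLawDichotomyStrainedPatchHomLeafCheckC
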